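import Literature.NumberTheory.GaloisRepresentations.CompletionCompositum
import Literature.NumberTheory.GaloisRepresentations.LocalWeilDatumExtension
import HarnessLib

/-!
# The image of `Γ_{E_w} → Γ_{K_v}` for EVERY place `w ∣ v` of a Galois extension `E/K`:
# `res(Γ_{E_w}) = Gal(K̄_v / K_v(E))` (Cassels–Fröhlich II §10, VII §1.1)

Topic `NumberTheory/GaloisRepresentations`, namespace `Literature.NumberTheory.GaloisRepresentations.SemiLocal`,
continuing `CompletionCompositum.lean` (the local–global dictionary `E ⊗_K K_v ≅ ∏_{w∣v} E_w`,
`G_w ≅ Gal(E_w/K_v)`).  Proof file: THEOREMS ONLY (no definition, no instance, no named fact, no `sorry`).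

Let `E/K` be a finite Galois extension of number fields, `v` a finite place of `K`, `K_v` its completion,
`K̄_v` the algebraic closure with `Γ_{K_v} = Gal(K̄_v/K_v)`, `K̄ → K̄_v` the tree's chosen embedding (so that
`res = absGaloisRestrict K K_v : Γ_{K_v} → Γ_K`), `ιE : E → K̄` a `K`-embedding and
`K_v(E) ⊆ K̄_v` the compositum (the subfield generated over `K_v` by the image of `E`).
`CompletionCompositum.lean` proves that `K_v(E)` is `K_v`-isomorphic to ONE completion `E_{w₀}`
(`exists_place_algHom_compositum`).  This file finishes the dictionary for ALL places above `v`: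

* `normal_compositum` — `K_v(E)/K_v` is normal (`K_v(E)` is `Γ_{K_v}`-stable, `smul_mem_compositum`);
* `exists_bijective_algHom_compositum_place` — for EVERY `w ∣ v` there is a `K_v`-isomorphism `K_v(E) → E_w`
  (transport along `g ∈ Gal(E/K)` with `g w₀ = w`, `SemiLocal.Place.exists_smul_eq`, `galAdicCompletionMap`);
* `range_absGaloisRestrict_adicCompletion_eq_of_liesOver` — the range is the same for any two places over `v`;
* `embField_place_eq_compositum` — the copy `embField K_v E_w ⊆ K̄_v` of `E_w` cut out by the tree's embedding
  `K̄_v → \bar{E_w}` (`LocalWeilDatum.embField`) IS `K_v(E)` (a `K_v`-embedded copy of the normal `K_v(E)`);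
* `range_absGaloisRestrict_place_eq` — **`range (Γ_{E_w} → Γ_{K_v}) = Gal(K̄_v/K_v(E))`** for every `w ∣ v`
  (`LocalWeilDatum.absGaloisRestrict_mem_galFixing` / `exists_absGaloisRestrict_eq`);
* `mem_range_absGaloisRestrict_place_iff` — **`d ∈ range (Γ_{E_w} → Γ_{K_v}) ↔ res d` fixes `ιE(E)` pointwise**,
  and `mem_range_absGaloisRestrict_adicCompletion_iff`, the same for a bare place `w'` of `E` with
  `w' ∣ v` (`adicCompletionOfLiesOver` algebra structure) — the form consumed by local Galois cohomology
  (transverse conditions `ker(H¹(K_v, M) → H¹(E_w, M))` only depend on `E`, not on `w`).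

## References

* J. W. S. Cassels, A. Fröhlich (eds.), *Algebraic Number Theory* (1967), Ch. II §10, Ch. VII §1.1 (Prop. 1.2).
  [CasselsFrohlichANT1967]
* J. Neukirch, *Algebraic Number Theory* (1999), Ch. II §8 (8.1)–(8.4), §9 (9.6). [NeukirchANT1999]
* J. Tate, *Number theoretic background*, Corvallis 1979, (1.4.5). [TateCorvallis1979]

## Tree search

`lean search 'range_absGaloisRestrict|embField|galFixing .*adjoin'`: `LocalWeilDatum.range_absGaloisRestrict_eq`
(`embField`, anabelian file `GaloisCyclotomeRestriction`), `SemiLocal.restrict_eq_one_iff` (kernel of `d ↦ d|_E` is the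
group of the compositum) and `mem_range_absGaloisRestrict_cyclotomic_iff` (the cyclotomic analogue) — no statement for
the completions `E_w`; this file supplies it.
-/

noncomputable section

open NumberField IsDedekindDomain IntermediateField Field
open scoped Valued

namespace Literature.NumberTheory.GaloisRepresentations

namespace SemiLocal

open Literature.NumberTheory.Automorphic LocalWeilDatum

universe u

variable {K : Type u} [Field K] [NumberField K] {E : Type u} [Field E] [NumberField E] [Algebra K E]
variable (v : HeightOneSpectrum (𝓞 K)) [IsGalois K E] (ιE : E →ₐ[K] AlgebraicClosure K)

omit [NumberField E] in
/-- **The compositum `K_v(E) ⊆ K̄_v` is normal over `K_v`**: it is stable under every `K_v`-automorphism of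
`K̄_v` (`smul_mem_compositum`: `d` acts on the image of `E` through its restriction `d|_E ∈ Gal(E/K)`).
[cite: CasselsFrohlichANT1967, Ch. VII §1.1] -/
theorem normal_compositum :
    Normal (v.adicCompletion K)
      (IntermediateField.adjoin (v.adicCompletion K)
        (Set.range ((absClosureEmbedding K (v.adicCompletion K)).comp ιE))) := by
  rw [IntermediateField.normal_iff_forall_map_le']
  intro σ
  rintro _ ⟨x, hx, rfl⟩
  obtain ⟨g, hg⟩ := exists_restrict v ιE ((absoluteGaloisGroup.toAlgEquiv (v.adicCompletion K)).symm σ)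
  have h := smul_mem_compositum v ιE hg hx
  rwa [absoluteGaloisGroup.toAlgEquiv_symm_apply] at h

/-- **Every completion `E_w`, `w ∣ v`, is `K_v`-isomorphic to the compositum**: there is a bijective
`K_v`-algebra homomorphism `K_v(E) → E_w` — for the place `w₀` of `exists_place_algHom_compositum` the map `θ`,
and for `w = g w₀` (`g ∈ Gal(E/K)`, `Place.exists_smul_eq`) the composite `g_* ∘ θ` with the `K_v`-linear
Galois transport `g_* : E_{w₀} → E_w` (`galAdicCompletionMap`, `galAdicCompletionMap_adicCompletionOfLiesOver`).
[cite: CasselsFrohlichANT1967, Ch. II §10, Ch. VII §1.1] -/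
theorem exists_bijective_algHom_compositum_place (w : Place K E v) :
    ∃ ψ : IntermediateField.adjoin (v.adicCompletion K)
          (Set.range ((absClosureEmbedding K (v.adicCompletion K)).comp ιE)) →ₐ[v.adicCompletion K]
        (w : HeightOneSpectrum (𝓞 E)).adicCompletion E, Function.Bijective ψ := by
  obtain ⟨w₀, θ, hθ⟩ := exists_place_algHom_compositum v ιE
  obtain ⟨g, hg⟩ := Place.exists_smul_eq w₀ w
  have h : g • (w₀ : HeightOneSpectrum (𝓞 E)) = (w : HeightOneSpectrum (𝓞 E)) := by
    rw [Place.smul_coe, hg]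
  -- `g_* : E_{w₀} → E_w` as a `K_v`-algebra map
  let T : (w₀ : HeightOneSpectrum (𝓞 E)).adicCompletion E →ₐ[v.adicCompletion K]
      (w : HeightOneSpectrum (𝓞 E)).adicCompletion E :=
    { toRingHom := galAdicCompletionMap g h
      commutes' := fun c => by
        change galAdicCompletionMap g h (algebraMap _ _ c) = algebraMap _ _ c
        rw [algebraMap_place_eq, algebraMap_place_eq]
        exact galAdicCompletionMap_adicCompletionOfLiesOver K g v h c }
  have hT : Function.Bijective T := (galAdicCompletionEquiv (L := E) g h).bijective
  exact ⟨T.comp θ, hT.comp (bijective_algHom_compositum v ιE θ hθ)⟩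

/-- **`embField K_v E_w = K_v(E)`** for every `w ∣ v`: the copy of `E_w` inside `K̄_v` cut out by the tree's embedding
`K̄_v → \bar{E_w}` (`LocalWeilDatum.embField`, `≅ E_w` over `K_v` by `equivEmbField`) is the image of a `K_v`-embedding
of the NORMAL extension `K_v(E) ≅ E_w`, hence equals `K_v(E)` (`AlgHom.fieldRange_of_normal`).
[cite: CasselsFrohlichANT1967, Ch. II §10, Ch. VII §1.1] [cite: TateCorvallis1979, §1.4 (1.4.5)] -/
theorem embField_place_eq_compositum (w : Place K E v) :
    embField (v.adicCompletion K) ((w : HeightOneSpectrum (𝓞 E)).adicCompletion E) =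
      IntermediateField.adjoin (v.adicCompletion K)
        (Set.range ((absClosureEmbedding K (v.adicCompletion K)).comp ιE)) := by
  haveI := finiteDimensional_place (v := v) w
  haveI := normal_compositum v ιE
  set C := IntermediateField.adjoin (v.adicCompletion K)
    (Set.range ((absClosureEmbedding K (v.adicCompletion K)).comp ιE)) with hC
  obtain ⟨ψ, hψ⟩ := exists_bijective_algHom_compositum_place v ιE w
  -- the `K_v`-embedding `K_v(E) ≅ E_w ≅ embField ↪ K̄_v`
  let σ : C →ₐ[v.adicCompletion K] AlgebraicClosure (v.adicCompletion K) :=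
    (embField (v.adicCompletion K) ((w : HeightOneSpectrum (𝓞 E)).adicCompletion E)).val.comp
      ((equivEmbField (v.adicCompletion K) ((w : HeightOneSpectrum (𝓞 E)).adicCompletion E)).toAlgHom.comp ψ)
  have hσ : σ.fieldRange =
      embField (v.adicCompletion K) ((w : HeightOneSpectrum (𝓞 E)).adicCompletion E) := by
    ext x
    constructor
    · rintro ⟨c, rfl⟩
      exact SetLike.coe_mem _
    · intro hx
      obtain ⟨y, hy⟩ := (equivEmbField (v.adicCompletion K)
        ((w : HeightOneSpectrum (𝓞 E)).adicCompletion E)).surjective ⟨x, hx⟩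
      obtain ⟨c, rfl⟩ := hψ.2 y
      refine ⟨c, ?_⟩
      change (((equivEmbField (v.adicCompletion K) ((w : HeightOneSpectrum (𝓞 E)).adicCompletion E)) (ψ c) :
          embField (v.adicCompletion K) ((w : HeightOneSpectrum (𝓞 E)).adicCompletion E)) :
          AlgebraicClosure (v.adicCompletion K)) = x
      rw [hy]
  rw [← hσ]
  exact AlgHom.fieldRange_of_normal σ

/-- **`range (Γ_{E_w} → Γ_{K_v}) = Gal(K̄_v / K_v(E))`** for every place `w ∣ v` of the Galois extension `E/K`
(the restriction along the local base change `K_v → E_w`; Cassels–Fröhlich VII §1.1: "`G_w ≅ Gal(E_w/K_v)`", kernel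
form).  [cite: CasselsFrohlichANT1967, Ch. VII §1.1, Prop. 1.2] [cite: TateCorvallis1979, §1.4 (1.4.5)] -/
theorem range_absGaloisRestrict_place_eq (w : Place K E v) :
    Set.range (absGaloisRestrict (v.adicCompletion K) ((w : HeightOneSpectrum (𝓞 E)).adicCompletion E)) =
      (galFixing (v.adicCompletion K)
        (IntermediateField.adjoin (v.adicCompletion K)
          (Set.range ((absClosureEmbedding K (v.adicCompletion K)).comp ιE))) :
        Set (absoluteGaloisGroup (v.adicCompletion K))) := by
  haveI := finiteDimensional_place (v := v) w
  haveI : Algebra.IsAlgebraic (v.adicCompletion K) ((w : HeightOneSpectrum (𝓞 E)).adicCompletion E) :=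
    Algebra.IsAlgebraic.of_finite _ _
  rw [← embField_place_eq_compositum v ιE w]
  ext γ
  constructor
  · rintro ⟨σ, rfl⟩
    exact absGaloisRestrict_mem_galFixing _ _ σ
  · intro hγ
    exact exists_absGaloisRestrict_eq _ _ hγ

/-- **`d ∈ range (Γ_{E_w} → Γ_{K_v})` iff `d|_{K̄}` fixes `ιE(E)` pointwise** (every `w ∣ v`): the group of the
compositum is the set of `d ∈ Γ_{K_v}` whose restriction `res d ∈ Γ_K` is the identity on the embedded `E`
(`K_v(E)` is generated by the image of `E`; the chosen `K̄ → K̄_v` is injective).  In particular the range does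
not depend on `w`. [cite: CasselsFrohlichANT1967, Ch. VII §1.1] -/
theorem mem_range_absGaloisRestrict_place_iff (w : Place K E v)
    (d : absoluteGaloisGroup (v.adicCompletion K)) :
    d ∈ Set.range (absGaloisRestrict (v.adicCompletion K) ((w : HeightOneSpectrum (𝓞 E)).adicCompletion E)) ↔
      ∀ e : E, absGaloisRestrict K (v.adicCompletion K) d • ιE e = ιE e := by
  rw [range_absGaloisRestrict_place_eq v ιE w, SetLike.mem_coe, mem_galFixing_iff]
  constructor
  · intro h e
    apply (absClosureEmbedding K (v.adicCompletion K)).toRingHom.injective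
    change absClosureEmbedding K (v.adicCompletion K) (absGaloisRestrict K (v.adicCompletion K) d • ιE e) =
      absClosureEmbedding K (v.adicCompletion K) (ιE e)
    rw [absGaloisRestrict_apply_smul]
    exact h _ (mem_compositum v ιE e)
  · intro h x hx
    refine smul_eq_self_of_mem_adjoin (v.adicCompletion K) (fun y hy => ?_) hx
    obtain ⟨e, rfl⟩ := hy
    change d • absClosureEmbedding K (v.adicCompletion K) (ιE e) = absClosureEmbedding K (v.adicCompletion K) (ιE e)
    rw [← absGaloisRestrict_apply_smul, h e]

/-- **The same for a bare place `w' ∣ v` of `E`** (local base change `adicCompletionOfLiesOver K E v w'` as the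
algebra structure, the form in which completions of an extension enter local Galois cohomology):
`d ∈ range (Γ_{E_{w'}} → Γ_{K_v}) ↔ res d` fixes `ιE(E)` pointwise. [cite: CasselsFrohlichANT1967, Ch. VII §1.1] -/
theorem mem_range_absGaloisRestrict_adicCompletion_iff (w' : HeightOneSpectrum (𝓞 E))
    [hw : w'.asIdeal.LiesOver v.asIdeal] (d : absoluteGaloisGroup (v.adicCompletion K)) :
    letI := (adicCompletionOfLiesOver K E v w').toAlgebra
    d ∈ Set.range (absGaloisRestrict (v.adicCompletion K) (w'.adicCompletion E)) ↔
      ∀ e : E, absGaloisRestrict K (v.adicCompletion K) d • ιE e = ιE e :=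
  mem_range_absGaloisRestrict_place_iff v ιE ⟨w', HeightOneSpectrum.ext hw.over.symm⟩ d

/-- **Independence of the place**: the ranges of `Γ_{E_{w₁}} → Γ_{K_v}` and `Γ_{E_{w₂}} → Γ_{K_v}` coincide for any
two places `w₁, w₂ ∣ v` (both are the group of the compositum). [cite: CasselsFrohlichANT1967, Ch. VII §1.1] -/
theorem range_absGaloisRestrict_adicCompletion_eq_of_liesOver (w₁ w₂ : HeightOneSpectrum (𝓞 E))
    [h₁ : w₁.asIdeal.LiesOver v.asIdeal] [h₂ : w₂.asIdeal.LiesOver v.asIdeal] :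
    Set.range (letI := (adicCompletionOfLiesOver K E v w₁).toAlgebra
        absGaloisRestrict (v.adicCompletion K) (w₁.adicCompletion E)) =
      Set.range (letI := (adicCompletionOfLiesOver K E v w₂).toAlgebra
        absGaloisRestrict (v.adicCompletion K) (w₂.adicCompletion E)) := by
  let ιE : E →ₐ[K] AlgebraicClosure K := IsAlgClosed.lift
  ext d
  exact (mem_range_absGaloisRestrict_adicCompletion_iff v ιE w₁ d).trans
    (mem_range_absGaloisRestrict_adicCompletion_iff v ιE w₂ d).symm

end SemiLocal

end Literature.NumberTheory.GaloisRepresentations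

end
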